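import Mathlib
import Literature.MathematicalPhysics.QuantumLattice.GermMarkov
import Literature.MathematicalPhysics.QuantumLattice.EuclideanAction
import Literature.MathematicalPhysics.QuantumLattice.GaussianFieldLaw
import Summits.CriticalPhenomena.Ising3DConformalLimit.Theorems.EnergyNotSigmaSquaredMoebiusLimitExistsDefs
import Summits.CriticalPhenomena.Ising3DConformalLimit.Theorems.MarkovRigidityFieldRealisationSmearedLimit
import Literature.Analysis.Potential.RieszKernelFourierPairingProofs
import Literature.MathematicalPhysics.QuantumLattice.GermMarkovSpectralCriterion
import HarnessLib

/-!
# Crux `GaussianLimitIsFree` (item stmt-CriticalPhenomena-2601), line `registered` (birth v3):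
# stub `stub_gaussMarkovRigidity` — a germ-Markov generalised free field on `ℝ³` has `Δ = 1/2`

Landed here: the conditional composition `stub_gaussMarkovRigidity_of_spectralCriterion` — the
registered stub signature verbatim after ONE named literature fact of the tree,
`Literature.MathematicalPhysics.QuantumLattice.InvSpectralDensityPolynomialOfGermMarkov` (Rozanov
1982, Ch. 3 §2.3 with Ch. 2 §3.5: a centred Gaussian stationary generalised field, germ-Markov for
all open balls, with tempered spectral density `φ` satisfying (2.19), has `1/φ` a.e. a polynomial).
The second classical input, the Fourier representation of the Riesz pairing
`∫∫ u(x)‖x−y‖^{-α}v(y)` (Stein 1970, Ch. V §1.1 Lemma 1(b)), is the PROVED tree theorem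
`Literature.Analysis.Potential.rieszKernel_fourier_pairing` (Gaussian subordination).  Proof:
(1) `n = 2` of the moment hypothesis gives `E_μ[ω(u)ω(v)] = A∫∫u(x)‖x−y‖^{-2Δ}v(y)`
(`twoPoint_eq_of_wickMoments`: null coincident set, temperate kernel); (2) the Riesz pairing makes
`φ = A c ‖ξ‖^{2Δ−3}` the spectral density, which is tempered with (2.19)
(`integrable_bracket_mul_norm_rpow_neg`, `integrable_bracket_mul_norm_rpow`); (3) Rozanov gives a
polynomial `P = 1/φ` a.e., hence `(A c)⁻¹‖ξ‖^{3−2Δ} = P(ξ)` everywhere by continuity; (4) on the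
axis `ξ = t e₀`, `K|t|^m = q(t)` with `m = 3 − 2Δ ∈ [1,2]` forces `m = 2`
(`eq_two_of_eval_eq_mul_abs_rpow`: `q(2t) = 2^m q(t)` and evenness), i.e. `Δ = 1/2`.  The
translation-invariance and reflection-positivity hypotheses of the stub are idle.
-/

noncomputable section

namespace Summit.CriticalPhenomena.Ising3DConformalLimit.Cruxes.GaussianLimitIsFree.Birth

open MeasureTheory
open scoped FourierTransform ComplexConjugate
open Literature.MathematicalPhysics.QuantumLattice
open Summit.CriticalPhenomena.Ising3DConformalLimit.MoebiusLimitExistsOnlyInteraction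
  (wickPower wickPower_two)
open Summit.CriticalPhenomena.Ising3DConformalLimit.MarkovRigidityFieldRealisation
  (integrable_indicator_ball_rpow_neg max_one_rpow_neg_le ae_mem_nonCoincident)

/-! ### Integrability of Riesz-type weights on `ℝ³` -/

/-- For an integrable measurable weight `0 ≤ w ≤ 1` on `ℝ³` and `0 ≤ a < 3`, `w · ‖·‖^{-a}` is
integrable (`‖x‖^{-a} ≤ max(1,‖x‖^{-a}) ≤ 1 + 𝟙_{‖x‖<1}‖x‖^{-a}`, local integrability of
`‖x‖^{-a}`). [folklore] -/
theorem integrable_weight_mul_norm_rpow_neg {w : (EuclideanSpace ℝ (Fin 3)) → ℝ} (hw : Integrable w) (hwm : Measurable w)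
    (h0 : ∀ x, 0 ≤ w x) (h1 : ∀ x, w x ≤ 1) {a : ℝ} (ha0 : 0 ≤ a) (ha : a < 3) :
    Integrable fun x : (EuclideanSpace ℝ (Fin 3)) => w x * ‖x‖ ^ (-a) := by
  have hj := integrable_indicator_ball_rpow_neg ha
  refine (hw.add hj).mono' ((hwm.mul (measurable_norm.pow_const _)).aestronglyMeasurable)
    (Filter.Eventually.of_forall fun x => ?_)
  have hk : 0 ≤ ‖x‖ ^ (-a) := Real.rpow_nonneg (norm_nonneg _) _
  have hind : 0 ≤ (Metric.ball (0 : (EuclideanSpace ℝ (Fin 3))) 1).indicator (fun v : (EuclideanSpace ℝ (Fin 3)) => ‖v‖ ^ (-a)) x :=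
    Set.indicator_nonneg (fun v _ => Real.rpow_nonneg (norm_nonneg v) _) x
  rw [Real.norm_eq_abs, abs_of_nonneg (mul_nonneg (h0 x) hk), Pi.add_apply]
  calc w x * ‖x‖ ^ (-a) ≤ w x * max 1 (‖x‖ ^ (-a)) :=
        mul_le_mul_of_nonneg_left (le_max_right _ _) (h0 x)
    _ ≤ w x * (1 + (Metric.ball (0 : (EuclideanSpace ℝ (Fin 3))) 1).indicator (fun v : (EuclideanSpace ℝ (Fin 3)) => ‖v‖ ^ (-a)) x) :=
        mul_le_mul_of_nonneg_left (max_one_rpow_neg_le a ha0 x) (h0 x)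
    _ = w x + w x * (Metric.ball (0 : (EuclideanSpace ℝ (Fin 3))) 1).indicator (fun v : (EuclideanSpace ℝ (Fin 3)) => ‖v‖ ^ (-a)) x := by ring
    _ ≤ w x + (Metric.ball (0 : (EuclideanSpace ℝ (Fin 3))) 1).indicator (fun v : (EuclideanSpace ℝ (Fin 3)) => ‖v‖ ^ (-a)) x := by
        gcongr
        exact mul_le_of_le_one_left hind (h1 x)

/-- The kernel `‖x‖^{-a}`, `0 ≤ a < 3`, is temperate on `ℝ³`: `(1 + ‖x‖)^{-4} ‖x‖^{-a}` is
integrable. [folklore] -/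
theorem integrable_one_add_norm_rpow_neg_mul_norm_rpow_neg {a : ℝ} (ha0 : 0 ≤ a) (ha : a < 3) :
    Integrable fun x : (EuclideanSpace ℝ (Fin 3)) => (1 + ‖x‖) ^ (-((4 : ℕ) : ℝ)) * ‖x‖ ^ (-a) := by
  have h4 : ((4 : ℕ) : ℝ) = 4 := by norm_num
  rw [h4]
  refine integrable_weight_mul_norm_rpow_neg (integrable_one_add_norm (by simp; norm_num))
    ((measurable_norm.const_add 1).pow_const _) (fun x => Real.rpow_nonneg (by positivity) _)
    (fun x => Real.rpow_le_one_of_one_le_of_nonpos (by linarith [norm_nonneg x]) (by norm_num))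
    ha0 ha

/-- The Japanese bracket `(1 + ‖ξ‖²)^{-2}` is an integrable weight in `[0,1]` on `ℝ³`. [folklore] -/
theorem integrable_bracket_neg_two :
    Integrable (fun ξ : (EuclideanSpace ℝ (Fin 3)) => (1 + ‖ξ‖ ^ 2) ^ (-(2 : ℝ))) ∧
      (∀ ξ : (EuclideanSpace ℝ (Fin 3)), 0 ≤ (1 + ‖ξ‖ ^ 2) ^ (-(2 : ℝ))) ∧ ∀ ξ : (EuclideanSpace ℝ (Fin 3)), (1 + ‖ξ‖ ^ 2) ^ (-(2 : ℝ)) ≤ 1 := by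
  refine ⟨?_, fun ξ => Real.rpow_nonneg (by positivity) _, fun ξ =>
    Real.rpow_le_one_of_one_le_of_nonpos (by nlinarith [norm_nonneg ξ]) (by norm_num)⟩
  have h := integrable_rpow_neg_one_add_norm_sq (E := (EuclideanSpace ℝ (Fin 3))) (μ := volume) (r := 4) (by simp; norm_num)
  refine h.congr (Filter.Eventually.of_forall fun ξ => ?_)
  norm_num

/-- Rozanov's temperedness (2.4) for the Riesz spectral density: `(1 + ‖ξ‖²)^{-2} ‖ξ‖^{-a}` is
integrable on `ℝ³` for `0 ≤ a < 3`. [folklore] -/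
theorem integrable_bracket_mul_norm_rpow_neg {a : ℝ} (ha0 : 0 ≤ a) (ha : a < 3) :
    Integrable fun ξ : (EuclideanSpace ℝ (Fin 3)) => (1 + ‖ξ‖ ^ 2) ^ (-((2 : ℕ) : ℝ)) * ‖ξ‖ ^ (-a) := by
  have h2 : ((2 : ℕ) : ℝ) = 2 := by norm_num
  rw [h2]
  obtain ⟨hi, h0, h1⟩ := integrable_bracket_neg_two
  exact integrable_weight_mul_norm_rpow_neg hi ((measurable_norm.pow_const _ |>.const_add
    1).pow_const _) h0 h1 ha0 ha

/-- Rozanov's condition (2.19) for the Riesz spectral density: `(1 + ‖ξ‖²)^{-3} ‖ξ‖^{s}` is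
integrable on `ℝ³` for `0 ≤ s ≤ 2` (bounded by `(1 + ‖ξ‖²)^{-2}`). [folklore] -/
theorem integrable_bracket_mul_norm_rpow {s : ℝ} (hs0 : 0 ≤ s) (hs : s ≤ 2) :
    Integrable fun ξ : (EuclideanSpace ℝ (Fin 3)) => (1 + ‖ξ‖ ^ 2) ^ (-((3 : ℕ) : ℝ)) * ‖ξ‖ ^ s := by
  have h3 : ((3 : ℕ) : ℝ) = 3 := by norm_num
  rw [h3]
  obtain ⟨hi, -, -⟩ := integrable_bracket_neg_two
  have hb1 : ∀ ξ : (EuclideanSpace ℝ (Fin 3)), (1 : ℝ) ≤ 1 + ‖ξ‖ ^ 2 := fun ξ => by nlinarith [norm_nonneg ξ]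
  have hcont₁ : Continuous fun ξ : (EuclideanSpace ℝ (Fin 3)) => (1 + ‖ξ‖ ^ 2) ^ (-(3 : ℝ)) :=
    (continuous_const.add (continuous_norm.pow 2)).rpow_const fun ξ =>
      Or.inl (zero_lt_one.trans_le (hb1 ξ)).ne'
  have hcont₂ : Continuous fun ξ : (EuclideanSpace ℝ (Fin 3)) => ‖ξ‖ ^ s := continuous_norm.rpow_const fun _ => Or.inr hs0
  refine hi.mono' (hcont₁.mul hcont₂).aestronglyMeasurable (Filter.Eventually.of_forall fun ξ => ?_)
  have hb : (1 : ℝ) ≤ 1 + ‖ξ‖ ^ 2 := hb1 ξ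
  have hbpos : (0 : ℝ) < 1 + ‖ξ‖ ^ 2 := zero_lt_one.trans_le hb
  have hns : ‖ξ‖ ^ s ≤ (1 + ‖ξ‖ ^ 2) ^ (1 : ℝ) := by
    have hle : ‖ξ‖ ≤ (1 + ‖ξ‖ ^ 2) ^ (1 / 2 : ℝ) := by
      rw [← Real.sqrt_eq_rpow]
      exact Real.le_sqrt_of_sq_le (by nlinarith [norm_nonneg ξ])
    calc ‖ξ‖ ^ s ≤ ((1 + ‖ξ‖ ^ 2) ^ (1 / 2 : ℝ)) ^ s :=
          Real.rpow_le_rpow (norm_nonneg _) hle hs0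
      _ = (1 + ‖ξ‖ ^ 2) ^ (1 / 2 * s) := (Real.rpow_mul hbpos.le _ _).symm
      _ ≤ (1 + ‖ξ‖ ^ 2) ^ (1 : ℝ) :=
          Real.rpow_le_rpow_of_exponent_le hb (by linarith)
  have hk : 0 ≤ ‖ξ‖ ^ s := Real.rpow_nonneg (norm_nonneg _) _
  have hw : 0 ≤ (1 + ‖ξ‖ ^ 2) ^ (-(3 : ℝ)) := Real.rpow_nonneg hbpos.le _
  rw [Real.norm_eq_abs, abs_of_nonneg (mul_nonneg hw hk)]
  calc (1 + ‖ξ‖ ^ 2) ^ (-(3 : ℝ)) * ‖ξ‖ ^ s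
      ≤ (1 + ‖ξ‖ ^ 2) ^ (-(3 : ℝ)) * (1 + ‖ξ‖ ^ 2) ^ (1 : ℝ) :=
        mul_le_mul_of_nonneg_left hns hw
    _ = (1 + ‖ξ‖ ^ 2) ^ (-(2 : ℝ)) := by
        rw [← Real.rpow_add hbpos]; norm_num

/-- The `n = 2` case of the moment hypothesis: a law with moment densities `(√A)ⁿ · W_Δ` has
two-point function `E_μ[ω(u)ω(v)] = A ∫∫ u(x) ‖x − y‖^{-2Δ} v(y) dy dx` (`0 < Δ < 3/2`; the
coincident configurations are null and the double integral converges absolutely). [folklore] -/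
theorem twoPoint_eq_of_wickMoments {Δ A : ℝ} (hA : 0 ≤ A) (hΔ0 : 0 < Δ) (hΔ : Δ < 3 / 2)
    {μ : Measure (FieldConfig (EuclideanSpace ℝ (Fin 3)))}
    (hmom : ∀ (n : ℕ) (f : Fin n → SchwartzMap (EuclideanSpace ℝ (Fin 3)) ℝ), moment μ n f =
      ∫ x : Fin n → (EuclideanSpace ℝ (Fin 3)), (Real.sqrt A ^ n * wickPower Δ n x) * ∏ i, f i (x i))
    (u v : SchwartzMap (EuclideanSpace ℝ (Fin 3)) ℝ) :
    twoPoint μ u v = A * ∫ x, ∫ y, u x * ‖x - y‖ ^ (-(2 * Δ)) * v y := by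
  have h2 : twoPoint μ u v = moment μ 2 ![u, v] := by
    simp only [twoPoint, moment, Fin.prod_univ_two, Matrix.cons_val_zero, Matrix.cons_val_one]
  rw [h2, hmom 2 ![u, v]]
  set F : (EuclideanSpace ℝ (Fin 3)) × (EuclideanSpace ℝ (Fin 3)) → ℝ := fun p => ‖p.1 - p.2‖ ^ (-(2 * Δ)) * u p.1 * v p.2 with hF
  have hae : (fun x : Fin 2 → (EuclideanSpace ℝ (Fin 3)) => (Real.sqrt A ^ 2 * wickPower Δ 2 x) * ∏ i, (![u, v] i) (x i))
      =ᵐ[volume] fun x => A * F (MeasurableEquiv.finTwoArrow x) := by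
    filter_upwards [ae_mem_nonCoincident 2] with x hx
    rw [wickPower_two hx, Real.sq_sqrt hA]
    simp only [hF, MeasurableEquiv.finTwoArrow_apply, Fin.prod_univ_two, Matrix.cons_val_zero,
      Matrix.cons_val_one]
    ring
  rw [integral_congr_ae hae, integral_const_mul,
    (volume_preserving_finTwoArrow (EuclideanSpace ℝ (Fin 3))).integral_comp' (f := MeasurableEquiv.finTwoArrow)]
  congr 1
  have hint : Integrable F (volume.prod volume) :=
    integrable_kernel_prod (K := fun z : (EuclideanSpace ℝ (Fin 3)) => ‖z‖ ^ (-(2 * Δ)))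
      (integrable_one_add_norm_rpow_neg_mul_norm_rpow_neg (a := 2 * Δ) (by linarith) (by linarith)) u v
  rw [show (volume : Measure ((EuclideanSpace ℝ (Fin 3)) × (EuclideanSpace ℝ (Fin 3)))) = volume.prod volume from rfl, integral_prod F hint]
  refine integral_congr_ae (Filter.Eventually.of_forall fun x => ?_)
  refine integral_congr_ae (Filter.Eventually.of_forall fun y => ?_)
  simp only [hF]
  ring

/-- If a real polynomial `q` satisfies `q(t) = K|t|^m` for all real `t`, with `K > 0` and
`1 ≤ m ≤ 2`, then `m = 2`: the identity `q(2X) = 2^m q(X)` compares leading coefficients to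
`2^{deg q} = 2^m`, so `m = deg q ∈ {1, 2}`, and `deg q = 1` contradicts `q(1) = q(−1)`. [folklore] -/
theorem eq_two_of_eval_eq_mul_abs_rpow {K m : ℝ} (hK : 0 < K) (hm1 : 1 ≤ m) (hm2 : m ≤ 2)
    (q : Polynomial ℝ) (h : ∀ t : ℝ, q.eval t = K * |t| ^ m) : m = 2 := by
  have hm0 : 0 < m := by linarith
  have hq1 : q.eval 1 = K := by rw [h]; simp
  have hq0 : q ≠ 0 := by
    rintro rfl
    rw [Polynomial.eval_zero] at hq1
    exact hK.ne' hq1.symm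
  have hlc : q.leadingCoeff ≠ 0 := Polynomial.leadingCoeff_ne_zero.2 hq0
  have hcomp : q.comp (Polynomial.C 2 * Polynomial.X) = Polynomial.C ((2 : ℝ) ^ m) * q := by
    refine Polynomial.funext fun t => ?_
    rw [Polynomial.eval_comp, Polynomial.eval_mul, Polynomial.eval_mul, Polynomial.eval_C,
      Polynomial.eval_X, Polynomial.eval_C, h, h, abs_mul, abs_two,
      Real.mul_rpow zero_le_two (abs_nonneg t)]
    ring
  have hX1 : (Polynomial.C (2 : ℝ) * Polynomial.X).natDegree = 1 :=
    Polynomial.natDegree_C_mul_X 2 two_ne_zero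
  have hlead := congrArg Polynomial.leadingCoeff hcomp
  rw [Polynomial.leadingCoeff_comp (by rw [hX1]; exact one_ne_zero), Polynomial.leadingCoeff_C_mul_X,
    Polynomial.leadingCoeff_mul, Polynomial.leadingCoeff_C] at hlead
  have hpow : (2 : ℝ) ^ (q.natDegree : ℝ) = (2 : ℝ) ^ m := by
    rw [Real.rpow_natCast]
    refine mul_left_cancel₀ hlc ?_
    rw [hlead, mul_comm]
  have hdeg : (q.natDegree : ℝ) = m := by
    have hl := congrArg Real.log hpow
    rw [Real.log_rpow two_pos, Real.log_rpow two_pos] at hl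
    exact mul_right_cancel₀ (Real.log_pos one_lt_two).ne' hl
  have hn1 : 1 ≤ q.natDegree := by exact_mod_cast (hdeg ▸ hm1 : (1 : ℝ) ≤ q.natDegree)
  have hn2 : q.natDegree ≤ 2 := by exact_mod_cast (hdeg ▸ hm2 : (q.natDegree : ℝ) ≤ 2)
  have hcases : q.natDegree = 1 ∨ q.natDegree = 2 := by omega
  rcases hcases with hn | hn
  · -- degree one contradicts evenness `q(1) = q(-1)`
    exfalso
    have hq := Polynomial.eq_X_add_C_of_natDegree_le_one hn.le
    have e1 := h 1
    have e2 := h (-1)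
    rw [hq] at e1 e2
    simp only [Polynomial.eval_add, Polynomial.eval_mul, Polynomial.eval_C, Polynomial.eval_X,
      abs_neg, abs_one, Real.one_rpow, mul_one] at e1 e2
    have hc1 : q.coeff 1 = 0 := by linarith
    apply hlc
    rw [Polynomial.leadingCoeff, hn, hc1]
  · rw [← hdeg, hn]; norm_num

/-! ### The stub, conditionally on the named fact -/

/-- **Stub `stub_gaussMarkovRigidity`, conditional form** (the registered stub signature verbatim,
as the consequent of the literature fact `InvSpectralDensityPolynomialOfGermMarkov` — Rozanov's
spectral Markov criterion; the Riesz-pairing input is the proved `rieszKernel_fourier_pairing`):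
for `A > 0`, `1/2 ≤ Δ ≤ 1` and a centred Gaussian probability law `μ` on `𝒮'(ℝ³)` which is
germ-Markov for every open ball and has moment densities `(√A)ⁿ · W_Δ`, `Δ = 1/2`.  The
translation-invariance and reflection-positivity hypotheses are not used.  Proof: steps 1–4 of the
module docstring (Pitt 1971; Kotani 1973, Thm 2; Rozanov 1982, Ch. 3 §2.3).
[cite: Rozanov1982, Ch. 3 §2.3 Theorem (p. 115)] -/
theorem stub_gaussMarkovRigidity_of_spectralCriterion :
    Literature.MathematicalPhysics.QuantumLattice.InvSpectralDensityPolynomialOfGermMarkov →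
    ∀ (Δ A : ℝ)
      (μ : MeasureTheory.Measure
        (Literature.MathematicalPhysics.QuantumLattice.FieldConfig (EuclideanSpace ℝ (Fin 3)))),
      0 < A → 1 / 2 ≤ Δ → Δ ≤ 1 →
      MeasureTheory.IsProbabilityMeasure μ →
      Literature.MathematicalPhysics.QuantumLattice.IsGaussianField μ →
      (∀ (c : EuclideanSpace ℝ (Fin 3)) (r : ℝ), 0 < r →
        Literature.MathematicalPhysics.QuantumLattice.CondIndepCondExp
          (Literature.MathematicalPhysics.QuantumLattice.germSigma (frontier (Metric.ball c r)))
          (Literature.MathematicalPhysics.QuantumLattice.germSigma (closure (Metric.ball c r)))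
          (Literature.MathematicalPhysics.QuantumLattice.germSigma (Metric.ball c r)ᶜ) μ) →
      Literature.MathematicalPhysics.QuantumLattice.IsTranslationInvariantLaw μ →
      (∀ (n : ℕ) (c : Fin n → ℂ) (f : Fin n → SchwartzMap (EuclideanSpace ℝ (Fin 3)) ℝ),
        (∀ i, tsupport ⇑(f i) ⊆ {x : EuclideanSpace ℝ (Fin 3) | 0 < x 0}) →
        0 ≤ (∑ i, ∑ j, (starRingEnd ℂ) (c i) * c j *
          Literature.MathematicalPhysics.QuantumLattice.genFunctional μ
            (f j - Literature.MathematicalPhysics.QuantumLattice.thetaTest 3 (f i))).re ∧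
        (∑ i, ∑ j, (starRingEnd ℂ) (c i) * c j *
          Literature.MathematicalPhysics.QuantumLattice.genFunctional μ
            (f j - Literature.MathematicalPhysics.QuantumLattice.thetaTest 3 (f i))).im = 0) →
      (∀ (n : ℕ) (f : Fin n → SchwartzMap (EuclideanSpace ℝ (Fin 3)) ℝ),
        Literature.MathematicalPhysics.QuantumLattice.moment μ n f =
          ∫ x : Fin n → EuclideanSpace ℝ (Fin 3),
            (Real.sqrt A ^ n *
              Summit.CriticalPhenomena.Ising3DConformalLimit.MoebiusLimitExistsOnlyInteraction.wickPower
                Δ n x) * ∏ i, f i (x i)) →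
      Δ = 1 / 2 := by
  intro hR Δ A μ hA hΔ1 hΔ2 hPμ hG hM _htr _hRP hmom
  -- Steps 1–2: spectral representation of the two-point function, density `φ = A c ‖ξ‖^{2Δ-3}`
  obtain ⟨c, hc, hFc⟩ :=
    Literature.Analysis.Potential.rieszKernel_fourier_pairing (2 * Δ) (by linarith) (by linarith)
  set φ : (EuclideanSpace ℝ (Fin 3)) → ℝ := fun ξ => A * c * ‖ξ‖ ^ (2 * Δ - 3) with hφ
  have hspec : ∀ u v : SchwartzMap (EuclideanSpace ℝ (Fin 3)) ℝ, twoPoint μ u v =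
      (∫ ξ, ((φ ξ : ℝ) : ℂ) * (𝓕 (fun x => ((u x : ℝ) : ℂ)) ξ *
        conj (𝓕 (fun x => ((v x : ℝ) : ℂ)) ξ))).re := by
    intro u v
    rw [twoPoint_eq_of_wickMoments hA.le (by linarith) (by linarith) hmom u v, hFc u v, ← mul_assoc,
      ← Complex.re_ofReal_mul, ← integral_const_mul]
    congr 1
    refine integral_congr_ae (Filter.Eventually.of_forall fun ξ => ?_)
    simp only [hφ]
    push_cast
    ring
  -- Step 3: the hypotheses of Rozanov's criterion for `φ`
  have hφm : Measurable φ := (measurable_norm.pow_const _).const_mul _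
  have hφ0 : ∀ ξ, 0 ≤ φ ξ := fun ξ =>
    mul_nonneg (mul_nonneg hA.le hc.le) (Real.rpow_nonneg (norm_nonneg _) _)
  have hφpos : ∀ᵐ ξ ∂(volume : Measure (EuclideanSpace ℝ (Fin 3))), 0 < φ ξ := by
    filter_upwards [Measure.ae_ne volume (0 : (EuclideanSpace ℝ (Fin 3)))] with ξ hξ
    exact mul_pos (mul_pos hA hc) (Real.rpow_pos_of_pos (norm_pos_iff.2 hξ) _)
  have hφeven : ∀ ξ, φ (-ξ) = φ ξ := fun ξ => by simp only [hφ, norm_neg]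
  have hφinv : ∀ ξ : (EuclideanSpace ℝ (Fin 3)), (φ ξ)⁻¹ = (A * c)⁻¹ * ‖ξ‖ ^ (3 - 2 * Δ) := fun ξ => by
    simp only [hφ]
    rw [mul_inv, ← Real.rpow_neg (norm_nonneg ξ), neg_sub]
  have h24 : Integrable (fun ξ : (EuclideanSpace ℝ (Fin 3)) => (1 + ‖ξ‖ ^ 2) ^ (-((2 : ℕ) : ℝ)) * φ ξ) := by
    have h := (integrable_bracket_mul_norm_rpow_neg (a := 3 - 2 * Δ) (by linarith)
      (by linarith)).const_mul (A * c)
    refine h.congr (Filter.Eventually.of_forall fun ξ => ?_)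
    simp only [hφ]
    rw [show -(3 - 2 * Δ) = 2 * Δ - 3 by ring]
    ring
  have h219 : Integrable (fun ξ : (EuclideanSpace ℝ (Fin 3)) => (1 + ‖ξ‖ ^ 2) ^ (-((3 : ℕ) : ℝ)) * (φ ξ)⁻¹) := by
    have h := (integrable_bracket_mul_norm_rpow (s := 3 - 2 * Δ) (by linarith)
      (by linarith)).const_mul (A * c)⁻¹
    refine h.congr (Filter.Eventually.of_forall fun ξ => ?_)
    beta_reduce
    rw [hφinv]
    ring
  -- Step 3: Rozanov's criterion gives a polynomial `P` with `1/φ = P` a.e.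
  obtain ⟨P, hPae⟩ := hR 3 μ φ hPμ hG hφm hφ0 hφpos hφeven ⟨2, h24⟩ ⟨3, h219⟩ hspec hM
  -- Step 4: `(A c)⁻¹ ‖ξ‖^{3-2Δ} = P(ξ)` everywhere, by continuity
  have hgc : Continuous fun ξ : (EuclideanSpace ℝ (Fin 3)) => (A * c)⁻¹ * ‖ξ‖ ^ (3 - 2 * Δ) :=
    continuous_const.mul (continuous_norm.rpow_const fun _ => Or.inr (by linarith))
  have hPc : Continuous fun ξ : (EuclideanSpace ℝ (Fin 3)) => MvPolynomial.eval (fun i => ξ i) P :=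
    (MvPolynomial.continuous_eval P).comp (PiLp.continuous_ofLp 2 (fun _ : Fin 3 => ℝ))
  have hae : (fun ξ : (EuclideanSpace ℝ (Fin 3)) => (A * c)⁻¹ * ‖ξ‖ ^ (3 - 2 * Δ)) =ᵐ[volume]
      fun ξ : (EuclideanSpace ℝ (Fin 3)) => MvPolynomial.eval (fun i => ξ i) P := by
    filter_upwards [hPae] with ξ hξ
    rw [← hφinv, hξ]
  have heq := (Continuous.ae_eq_iff_eq volume hgc hPc).1 hae
  -- restriction to the first coordinate axis: a one-variable polynomial `q` with `q(t) = K|t|^m`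
  set s : Fin 3 → Polynomial ℝ := fun i => if i = 0 then Polynomial.X else 0 with hs
  have hqeval : ∀ t : ℝ, (MvPolynomial.aeval s P).eval t = (A * c)⁻¹ * |t| ^ (3 - 2 * Δ) := by
    intro t
    have h1 : (MvPolynomial.aeval s P).eval t =
        MvPolynomial.eval (fun i => (EuclideanSpace.single (0 : Fin 3) t : (EuclideanSpace ℝ (Fin 3))) i) P := by
      rw [← Polynomial.coe_aeval_eq_eval, MvPolynomial.comp_aeval_apply, MvPolynomial.aeval_eq_eval]
      have hfg : (fun i => Polynomial.aeval t (s i)) =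
          fun i => (EuclideanSpace.single (0 : Fin 3) t : (EuclideanSpace ℝ (Fin 3))) i := by
        funext i
        by_cases hi : i = 0
        · subst hi
          simp [hs]
        · simp [hs, hi]
      rw [hfg]
    have h3 := congrFun heq (EuclideanSpace.single (0 : Fin 3) t)
    simp only [PiLp.norm_single, Real.norm_eq_abs] at h3
    rw [h1, ← h3]
  -- Step 4: rigidity on the line
  have hm := eq_two_of_eval_eq_mul_abs_rpow (inv_pos.2 (mul_pos hA hc)) (by linarith) (by linarith)
    (MvPolynomial.aeval s P) hqeval
  linarith

end Summit.CriticalPhenomena.Ising3DConformalLimit.Cruxes.GaussianLimitIsFree.Birth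

end
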